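import Literature.Computability.Cryptography.LWENoiseJitter
import Literature.Computability.Cryptography.PQCLWEProofs
import HarnessLib

/-!
# Re-continuising discretised `LWE` samples: `U ↦ U` exactly, `A_{s,Ψ̄_α} ↦ A_{s,φ̃}` with `Δ(φ̃, Ψ_α) ≤ 2/(αQ)`

Topic `Computability/Cryptography` (family `pqc`), grouping namespace `LWE`; sequel of
`LWENoiseJitter.lean` (the noise-level estimate) and converse companion of `LWETorusDiscretize.lean`
(Regev's Lemma 4.3, torus `↦` discrete). The sample-level ADAPTER from the discretised oracle interfaces
of `LWEHardness.lean` / `BLPRSReduction.lean` (samples `(a, b̄) ∈ ℤ_Qⁿ × ℤ_Q`, noise `Ψ̄_α`) to the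
continuous-noise model on which BLPRS's chain is proved (`LWEModulusSwitchSamples.lean`, Cor. 3.2;
Thm. 4.1): replace `b̄` by a uniformly random point of its grid cell, `(b̄ + u)/Q mod 1`,
`u ← U[-1/2,1/2)`. Everything is PROVED; no named fact.

## Results

* `recontPhase`, `recontKernel Q (a, b̄)` (the Markov kernel `(a, b̄) ↦ (a, (b̄+u)/Q mod 1)`),
  `recont Q P = P.bind K` (the re-continuised law of an input `PMF`), `recont_apply`.
* `iUnion_cell_val_eq` (the cells `C_0,…,C_{Q-1}` tile `[-1/(2Q), 1-1/(2Q))`),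
  **`sum_unitUniform_recontPhase`** (`∑_{b̄} Pr_u[(b̄+u)/Q mod 1 ∈ T] = Q·vol(T)`: the window is a
  fundamental domain, `UnitAddCircle.measurePreserving_mk`), hence **`recont_uniform`**: a uniform
  discretised sample becomes EXACTLY a uniform torus sample `U(ℤ_Qⁿ) ⊗ Haar`.
* `recontNoise Q α = φ̃` (the jittered Gaussian mod 1), `statDist_recontNoise_wrappedGaussian_le`
  (**`Δ(φ̃, Ψ_α) ≤ 2/(αQ)`**), `recontNoise_apply`; `recontPhase_add_eq` (the congruence
  `((⟨a,s⟩+j).val + u)/Q ≡ ⟨a,s⟩.val/Q + (k+u)/Q (mod 1)` for `k ≡ j`), `discretizedGaussian_eq_tsum_cells`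
  (`Ψ̄_α(j) = ∑_{k ≡ j} D_α(C_k)`), `sum_tsum_fibre_eq_tsum`; hence
  **`recont_lweSample_discretizedGaussian`**: `A_{s,Ψ̄_α}` becomes EXACTLY `A_{s,φ̃}`
  (`torusLWESample Q φ̃ s`), and **`statDist_recont_lweSample_torusLWESample_le`**:
  `Δ(recont A_{s,Ψ̄_α}, A_{s,Ψ_α}) ≤ 2/(αQ)`.

With `m` independent samples the costs add up to `2m/(αQ)` (`piKernel`, `statDist_pi_le_sum`), negligible
for `Q = 2^{√n/2}`.

## References

* O. Regev, *On lattices, learning with errors, random linear codes, and cryptography*, J. ACM 56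
  (2009), §2 and Lemma 4.3 [RegevLWE2009].
* Z. Brakerski, A. Langlois, C. Peikert, O. Regev, D. Stehlé, *Classical hardness of learning with
  errors*, STOC 2013, p. 13 [BrakerskiEtAl2013].
-/

noncomputable section

open MeasureTheory ProbabilityTheory Literature.Algebra.EuclideanLattices
open scoped ENNReal NNReal Real

namespace Literature.Computability.Cryptography

namespace LWE

variable {ι : Type} [Fintype ι] [DecidableEq ι] (Q : ℕ) [NeZero Q]

/-! ### The re-continuisation kernel on one sample -/

/-- The re-continuised second coordinate: `(b̄, u) ↦ (b̄.val + u)/Q mod 1`. [folklore] -/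
def recontPhase (b : ZMod Q) (u : ℝ) : UnitAddCircle := ((((b.val : ℝ) + u) / Q : ℝ) : UnitAddCircle)

omit [NeZero Q] in
/-- Measurability in `u`. [folklore] -/
theorem measurable_recontPhase (b : ZMod Q) : Measurable (recontPhase Q b) :=
  measurable_coe_unitAddCircle.comp ((measurable_const_add _).div_const _)

/-- **The re-continuisation kernel**: on a discretised sample `(a, b̄) ∈ ℤ_Qⁿ × ℤ_Q` output
`(a, (b̄ + u)/Q mod 1)` with a fresh `u ← U[-1/2,1/2)` — a uniformly random point of the grid cell that the
rounding `b̄ = ⌊Qb⌉ mod Q` remembers. [folklore] -/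
def recontKernel (p : (ι → ZMod Q) × ZMod Q) : Measure ((ι → ZMod Q) × UnitAddCircle) :=
  unitUniform.map fun u : ℝ => (p.1, recontPhase Q p.2 u)

omit [Fintype ι] [DecidableEq ι] [NeZero Q] in
/-- Measurability of `u ↦ (a, phase)`. [folklore] -/
theorem measurable_mk_recontPhase (a : ι → ZMod Q) (b : ZMod Q) :
    Measurable fun u : ℝ => (a, recontPhase Q b u) :=
  measurable_const.prodMk (measurable_recontPhase Q b)

omit [Fintype ι] [DecidableEq ι] [NeZero Q] in
/-- The kernel on a measurable set. [folklore] -/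
theorem recontKernel_apply (p : (ι → ZMod Q) × ZMod Q) {S : Set ((ι → ZMod Q) × UnitAddCircle)}
    (hS : MeasurableSet S) :
    recontKernel Q p S = unitUniform {u : ℝ | (p.1, recontPhase Q p.2 u) ∈ S} := by
  rw [recontKernel, Measure.map_apply (measurable_mk_recontPhase Q _ _) hS]
  rfl

omit [Fintype ι] [DecidableEq ι] [NeZero Q] in
/-- The kernel is Markov. [folklore] -/
instance isProbabilityMeasure_recontKernel (p : (ι → ZMod Q) × ZMod Q) :
    IsProbabilityMeasure (recontKernel Q p) :=
  Measure.isProbabilityMeasure_map (measurable_mk_recontPhase Q _ _).aemeasurable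

/-- The re-continuised law of an input law `P` of discretised samples. [folklore] -/
def recont (P : PMF ((ι → ZMod Q) × ZMod Q)) : Measure ((ι → ZMod Q) × UnitAddCircle) :=
  P.toMeasure.bind (recontKernel Q)

/-- `recont P (S) = ∑_{(a, b̄)} P(a, b̄) · Pr_u[(a, (b̄+u)/Q mod 1) ∈ S]`. [folklore] -/
theorem recont_apply (P : PMF ((ι → ZMod Q) × ZMod Q)) {S : Set ((ι → ZMod Q) × UnitAddCircle)}
    (hS : MeasurableSet S) :
    recont Q P S = ∑ p : (ι → ZMod Q) × ZMod Q, P p * unitUniform {u : ℝ | (p.1, recontPhase Q p.2 u) ∈ S} := by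
  rw [recont, Measure.bind_apply hS (measurable_of_countable _).aemeasurable, lintegral_fintype]
  refine Finset.sum_congr rfl fun p _ => ?_
  rw [recontKernel_apply Q p hS, PMF.toMeasure_apply_singleton _ _ (measurableSet_singleton _), mul_comm]

/-- The re-continuised law of a probability input is a probability measure. [folklore] -/
instance isProbabilityMeasure_recont (P : PMF ((ι → ZMod Q) × ZMod Q)) : IsProbabilityMeasure (recont Q P) := by
  constructor
  rw [recont, Measure.bind_apply MeasurableSet.univ (measurable_of_countable _).aemeasurable]
  simp

/-! ### The window `[-1/(2Q), 1 - 1/(2Q))` of `Q` consecutive cells is a fundamental domain -/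

/-- The cells `C_0, …, C_{Q-1}` tile the window `[-1/(2Q), 1 - 1/(2Q))`. [folklore] -/
theorem iUnion_cell_val_eq :
    (⋃ b : ZMod Q, cellIndex Q ⁻¹' {((b.val : ℕ) : ℤ)}) =
      Set.Ico (-(1 / 2 : ℝ) / Q) (1 - (1 / 2 : ℝ) / Q) := by
  have hQ : (0 : ℝ) < Q := by exact_mod_cast Nat.pos_of_ne_zero (NeZero.ne Q)
  ext x
  simp only [Set.mem_iUnion, Set.mem_preimage, Set.mem_singleton_iff, Set.mem_Ico]
  constructor
  · rintro ⟨b, hb⟩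
    rw [cellIndex_eq_iff] at hb
    obtain ⟨h1, h2⟩ := hb
    have hv0 : (0 : ℝ) ≤ b.val := Nat.cast_nonneg _
    have hv1 : (b.val : ℝ) ≤ Q - 1 := by
      have := ZMod.val_lt b
      have : (b.val : ℝ) + 1 ≤ Q := by exact_mod_cast this
      linarith
    push_cast at h1 h2
    constructor
    · refine le_trans ?_ h1
      exact div_le_div_of_nonneg_right (by linarith) hQ.le
    · refine lt_of_lt_of_le h2 ?_
      rw [div_le_iff₀ hQ, sub_mul, div_mul_cancel₀ _ hQ.ne', one_mul]
      linarith
  · rintro ⟨h1, h2⟩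
    -- the cell index of `x` lies in `{0, …, Q-1}`
    set k := cellIndex Q x with hk
    have hkb := (cellIndex_eq_iff Q x k).1 rfl
    obtain ⟨hk1, hk2⟩ := hkb
    have hk0 : 0 ≤ k := by
      by_contra hneg
      have hneg' := not_le.1 hneg
      have : (k : ℝ) ≤ -1 := by exact_mod_cast (show k ≤ -1 by omega)
      have : ((k : ℝ) + 1 / 2) / Q ≤ -(1 / 2 : ℝ) / Q := div_le_div_of_nonneg_right (by linarith) hQ.le
      linarith
    have hkQ : k < Q := by
      by_contra hge
      have hge' := not_lt.1 hge
      have : (Q : ℝ) ≤ k := by exact_mod_cast hge'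
      have : 1 - (1 / 2 : ℝ) / Q ≤ ((k : ℝ) - 1 / 2) / Q := by
        rw [le_div_iff₀ hQ, sub_mul, div_mul_cancel₀ _ hQ.ne', one_mul]
        linarith
      linarith
    refine ⟨(k.toNat : ZMod Q), ?_⟩
    rw [ZMod.val_natCast, Nat.mod_eq_of_lt (by omega), Int.toNat_of_nonneg hk0]

/-- **Summing the jitter fibres over the `Q` residues gives `Q` times Haar measure**: for a measurable
`T ⊆ 𝕋`, `∑_{b̄ ∈ ℤ_Q} Pr_u[(b̄ + u)/Q mod 1 ∈ T] = Q · vol(T)` (the cells `C_0, …, C_{Q-1}` tile a window of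
length one, on which `mod 1` is measure preserving). [folklore] -/
theorem sum_unitUniform_recontPhase (T : Set UnitAddCircle) (hT : MeasurableSet T) :
    ∑ b : ZMod Q, unitUniform {u : ℝ | recontPhase Q b u ∈ T} = (Q : ℝ≥0∞) * volume T := by
  have hQ : (0 : ℝ) < Q := by exact_mod_cast Nat.pos_of_ne_zero (NeZero.ne Q)
  set A : Set ℝ := ((↑) : ℝ → UnitAddCircle) ⁻¹' T with hA
  have hAm : MeasurableSet A := measurable_coe_unitAddCircle hT
  -- each fibre through the cell lemma
  have hfib : ∀ b : ZMod Q, unitUniform {u : ℝ | recontPhase Q b u ∈ T} =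
      (Q : ℝ≥0∞) * volume (A ∩ cellIndex Q ⁻¹' {((b.val : ℕ) : ℤ)}) := by
    intro b
    have hset : {u : ℝ | recontPhase Q b u ∈ T} = {u : ℝ | ((((b.val : ℕ) : ℤ) : ℝ) + u) / Q ∈ A} := by
      ext u
      simp only [Set.mem_setOf_eq, hA, Set.mem_preimage, recontPhase, Int.cast_natCast]
    rw [hset, unitUniform_jitter_fibre Q _ hAm]
  simp_rw [hfib]
  rw [← Finset.mul_sum]
  congr 1
  -- the cells are disjoint and tile the window
  have hdisj : Pairwise fun b b' : ZMod Q =>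
      Disjoint (A ∩ cellIndex Q ⁻¹' {((b.val : ℕ) : ℤ)}) (A ∩ cellIndex Q ⁻¹' {((b'.val : ℕ) : ℤ)}) := by
    intro b b' hbb'
    refine Set.disjoint_left.2 fun x hx hx' => hbb' ?_
    have h1 : cellIndex Q x = b.val := hx.2
    have h2 : cellIndex Q x = b'.val := hx'.2
    have : b.val = b'.val := by exact_mod_cast h1.symm.trans h2
    exact ZMod.val_injective Q this
  have hmeas : ∀ b : ZMod Q, MeasurableSet (A ∩ cellIndex Q ⁻¹' {((b.val : ℕ) : ℤ)}) := fun b =>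
    hAm.inter (measurableSet_cell Q _)
  rw [← tsum_fintype (L := SummationFilter.unconditional _), ← measure_iUnion hdisj hmeas,
    ← Set.inter_iUnion, iUnion_cell_val_eq]
  -- `mod 1` is measure preserving on the window `(t, t+1]`, `t = -1/(2Q)`, and `Ico` vs `Ioc` is null
  have hmp := (UnitAddCircle.measurePreserving_mk (-(1 / 2 : ℝ) / Q)).measure_preimage hT.nullMeasurableSet
  rw [Measure.restrict_apply' measurableSet_Ioc] at hmp
  rw [← hmp, show -(1 / 2 : ℝ) / Q + 1 = 1 - (1 / 2 : ℝ) / Q by ring]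
  exact measure_congr ((ae_eq_refl A).inter Ico_ae_eq_Ioc)

/-! ### A uniform discretised sample becomes a uniform torus sample, exactly -/

/-- Fibrewise decomposition of a measure on `ℤ_Qⁿ × 𝕋` (LOCAL copy of the elementary identity
`μ(S) = ∑_a μ({a} × S_a)`). [folklore] -/
theorem measure_eq_sum_fibre (μ : Measure ((ι → ZMod Q) × UnitAddCircle)) {S : Set ((ι → ZMod Q) × UnitAddCircle)}
    (hS : MeasurableSet S) : μ S = ∑ a : ι → ZMod Q, μ ({a} ×ˢ (Prod.mk a ⁻¹' S)) := by
  have hdecomp : S = ⋃ a : ι → ZMod Q, ({a} ×ˢ (Prod.mk a ⁻¹' S)) := by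
    ext ⟨a, t⟩
    simp
  conv_lhs => rw [hdecomp]
  rw [measure_iUnion, tsum_fintype (L := SummationFilter.unconditional _)]
  · intro a a' h
    exact Set.disjoint_prod.2 (Or.inl (Set.disjoint_singleton.2 h))
  · exact fun a => (measurableSet_singleton a).prod (measurable_prodMk_left hS)

/-- **Re-continuising a uniform discretised sample gives EXACTLY a uniform torus sample**:
`U(ℤ_Qⁿ × ℤ_Q) ↦ U(ℤ_Qⁿ) ⊗ Haar(𝕋)`. [folklore] -/
theorem recont_uniform :
    recont Q (PMF.uniformOfFintype ((ι → ZMod Q) × ZMod Q)) =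
      (PMF.uniformOfFintype (ι → ZMod Q)).toMeasure.prod (volume : Measure UnitAddCircle) := by
  ext S hS
  rw [recont_apply Q _ hS, measure_eq_sum_fibre Q _ hS, Fintype.sum_prod_type]
  refine Finset.sum_congr rfl fun a _ => ?_
  simp_rw [PMF.uniformOfFintype_apply]
  rw [← Finset.mul_sum, Measure.prod_prod, PMF.toMeasure_apply_singleton _ _ (measurableSet_singleton a),
    PMF.uniformOfFintype_apply, Fintype.card_prod, ZMod.card]
  have hfib : ∀ b : ZMod Q, unitUniform {u : ℝ | (a, recontPhase Q b u) ∈ S} =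
      unitUniform {u : ℝ | recontPhase Q b u ∈ Prod.mk a ⁻¹' S} := fun b => rfl
  simp only [hfib]
  rw [sum_unitUniform_recontPhase Q _ (measurable_prodMk_left hS), ← mul_assoc]
  congr 1
  rw [Nat.cast_mul, ENNReal.mul_inv (Or.inl (by exact_mod_cast Fintype.card_ne_zero))
    (Or.inl (ENNReal.natCast_ne_top _)), mul_assoc,
    ENNReal.inv_mul_cancel (by exact_mod_cast NeZero.ne Q) (ENNReal.natCast_ne_top _), mul_one]

/-! ### An `A_{s,Ψ̄_α}` sample becomes an `A_{s,φ̃}` sample with `φ̃` the jittered noise mod 1 -/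

/-- **The re-continuised noise** `φ̃`: `(⌊Qe⌉ + u)/Q mod 1` for `e ← D_α`, `u ← U[-1/2,1/2)`.
[folklore] -/
def recontNoise (α : ℝ) : Measure UnitAddCircle :=
  (((gaussianReal 0 (widthVar α)).prod unitUniform).map (jitter Q)).map ((↑) : ℝ → UnitAddCircle)

/-- `φ̃` is a probability measure. [folklore] -/
instance isProbabilityMeasure_recontNoise (α : ℝ) : IsProbabilityMeasure (recontNoise Q α) :=
  Measure.isProbabilityMeasure_map measurable_coe_unitAddCircle.aemeasurable

/-- **`Δ(φ̃, Ψ_α) ≤ 2/(αQ)`** (`LWENoiseJitter.statDist_jitterLaw_gaussian_le` and data processing under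
`mod 1`). [folklore] -/
theorem statDist_recontNoise_wrappedGaussian_le {α : ℝ} (hα : 0 < α) :
    statDist (recontNoise Q α) (wrappedGaussian α) ≤ 2 / (α * Q) := by
  rw [recontNoise, wrappedGaussian]
  exact (statDist_map_le measurable_coe_unitAddCircle _ _).trans (statDist_jitterLaw_gaussian_le Q hα)

/-- `φ̃` of a measurable set, through the cells: `φ̃(W) = ∑_k D_α(C_k) · Pr_u[(k+u)/Q mod 1 ∈ W]`. [folklore] -/
theorem recontNoise_apply (α : ℝ) {W : Set UnitAddCircle} (hW : MeasurableSet W) :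
    recontNoise Q α W = ∑' k : ℤ, gaussianReal 0 (widthVar α) (cellIndex Q ⁻¹' {k}) *
      unitUniform {u : ℝ | ((((k : ℝ) + u) / Q : ℝ) : UnitAddCircle) ∈ W} := by
  have hA : MeasurableSet (((↑) : ℝ → UnitAddCircle) ⁻¹' W) := measurable_coe_unitAddCircle hW
  rw [recontNoise, Measure.map_apply measurable_coe_unitAddCircle hW, jitterLaw_apply Q _ hA]
  refine tsum_congr fun k => ?_
  rw [← unitUniform_jitter_fibre Q k hA]
  rfl

/-- The phase of a discrete sample as a real number, `(⟨a, s⟩).val / Q`. [folklore] -/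
def dphase (s a : ι → ZMod Q) : ℝ := ((a ⬝ᵥ s).val : ℝ) / Q

omit [DecidableEq ι] in
/-- **The key congruence**: for an integer `k` with residue `j`, `((⟨a,s⟩ + j).val + u)/Q ≡ ⟨a,s⟩.val/Q + (k + u)/Q (mod 1)`.
[folklore] -/
theorem recontPhase_add_eq (s a : ι → ZMod Q) (k : ℤ) (u : ℝ) :
    recontPhase Q (a ⬝ᵥ s + (k : ZMod Q)) u =
      ((dphase Q s a : ℝ) : UnitAddCircle) + ((((k : ℝ) + u) / Q : ℝ) : UnitAddCircle) := by
  have hQ : (Q : ℝ) ≠ 0 := by exact_mod_cast NeZero.ne Q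
  -- `(⟨a,s⟩ + j).val ≡ ⟨a,s⟩.val + k (mod Q)`
  have hcong : (((a ⬝ᵥ s + (k : ZMod Q)).val : ℤ) : ZMod Q) = ((((a ⬝ᵥ s).val : ℤ) + k : ℤ) : ZMod Q) := by
    push_cast
    rw [ZMod.natCast_zmod_val, ZMod.natCast_zmod_val]
  obtain ⟨c, hc⟩ := (ZMod.intCast_eq_intCast_iff_dvd_sub _ _ _).1 hcong
  rw [recontPhase, dphase, ← AddCircle.coe_add, ← sub_eq_zero, ← AddCircle.coe_sub, AddCircle.coe_eq_zero_iff]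
  refine ⟨-c, ?_⟩
  have hc' : (((a ⬝ᵥ s).val : ℝ) + k) - ((a ⬝ᵥ s + (k : ZMod Q)).val : ℝ) = (Q : ℝ) * c := by
    have := congrArg (fun z : ℤ => (z : ℝ)) hc
    push_cast at this
    linarith
  rw [zsmul_eq_mul, mul_one]
  push_cast
  field_simp
  linarith

omit [Fintype ι] [DecidableEq ι] in
/-- Regrouping a sum over `ℤ` by residues modulo `Q`. [folklore] -/
theorem sum_tsum_fibre_eq_tsum (g : ℤ → ℝ≥0∞) :
    ∑ j : ZMod Q, ∑' k : {k : ℤ // (k : ZMod Q) = j}, g k = ∑' k : ℤ, g k := by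
  rw [← tsum_fintype (L := SummationFilter.unconditional _),
    ← ENNReal.tsum_sigma' (fun p : Σ j : ZMod Q, {k : ℤ // (k : ZMod Q) = j} => g p.2),
    ← (Equiv.sigmaFiberEquiv fun k : ℤ => (k : ZMod Q)).tsum_eq]
  rfl

omit [Fintype ι] [DecidableEq ι] in
/-- `Ψ̄_α(j)` is the Gaussian mass of the cells of residue `j`. [folklore] -/
theorem discretizedGaussian_eq_tsum_cells (α : ℝ) (j : ZMod Q) :
    discretizedGaussian Q α j =
      ∑' k : {k : ℤ // (k : ZMod Q) = j}, gaussianReal 0 (widthVar α) (cellIndex Q ⁻¹' {(k : ℤ)}) := by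
  rw [discretizedGaussian_apply]
  have hset : discretize Q ⁻¹' {j} = ⋃ k : {k : ℤ // (k : ZMod Q) = j}, cellIndex Q ⁻¹' {(k : ℤ)} := by
    ext x
    simp only [Set.mem_preimage, Set.mem_singleton_iff, Set.mem_iUnion]
    constructor
    · intro hx
      exact ⟨⟨cellIndex Q x, hx⟩, rfl⟩
    · rintro ⟨⟨k, hk⟩, hx⟩
      have hx' : cellIndex Q x = k := hx
      rw [← hk, show discretize Q x = ((cellIndex Q x : ℤ) : ZMod Q) from rfl, hx']
  rw [hset, measure_iUnion]
  · rfl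
  · intro k k' hkk'
    refine Set.disjoint_left.2 fun x hx hx' => hkk' (Subtype.ext ?_)
    have h1 : cellIndex Q x = k := hx
    have h2 : cellIndex Q x = k' := hx'
    rw [← h1, ← h2]
  · exact fun k => measurableSet_cell Q _

/-- **Re-continuising `A_{s,Ψ̄_α}` gives EXACTLY `A_{s,φ̃}`** (the torus sample law with the jittered noise):
`b̄ = ⟨a,s⟩ + ⌊Qe⌉` and `(b̄ + u)/Q ≡ ⟨a,s⟩/Q + (⌊Qe⌉ + u)/Q (mod 1)`. [folklore] -/
theorem recont_lweSample_discretizedGaussian (α : ℝ) (s : ι → ZMod Q) :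
    recont Q (lweSample (discretizedGaussian Q α) s) = torusLWESample Q (recontNoise Q α) s := by
  ext S hS
  rw [recont_apply Q _ hS, Fintype.sum_prod_type, torusLWESample,
    Measure.map_apply (measurable_torusSampleMap Q s) hS,
    measure_eq_sum_fibre Q _ ((measurable_torusSampleMap Q s) hS)]
  refine Finset.sum_congr rfl fun a _ => ?_
  have hWm : MeasurableSet (Prod.mk a ⁻¹' (torusSampleMap Q s ⁻¹' S)) :=
    measurable_prodMk_left ((measurable_torusSampleMap Q s) hS)
  rw [Measure.prod_prod, PMF.toMeasure_apply_singleton _ _ (measurableSet_singleton a),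
    PMF.uniformOfFintype_apply, recontNoise_apply Q α hWm]
  -- the weight of the jittered noise for the integer `k`
  set V : ℤ → ℝ≥0∞ := fun k => unitUniform {u : ℝ |
    (a, ((dphase Q s a : ℝ) : UnitAddCircle) + ((((k : ℝ) + u) / Q : ℝ) : UnitAddCircle)) ∈ S} with hV
  have hRHS : ∀ k : ℤ, unitUniform {u : ℝ | ((((k : ℝ) + u) / Q : ℝ) : UnitAddCircle) ∈
      Prod.mk a ⁻¹' (torusSampleMap Q s ⁻¹' S)} = V k := fun k => rfl
  simp_rw [hRHS]
  -- left-hand side: mass formula, reindex `b̄ = ⟨a,s⟩ + j`, expand `Ψ̄_α(j)` over the cells of residue `j`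
  simp_rw [lweSample_mass]
  rw [← Equiv.sum_comp (Equiv.addLeft (a ⬝ᵥ s))]
  simp only [Equiv.coe_addLeft, add_sub_cancel_left]
  have hcard : ((Fintype.card (ZMod Q) : ℝ≥0∞) ^ Fintype.card ι)⁻¹ = (Fintype.card (ι → ZMod Q) : ℝ≥0∞)⁻¹ := by
    rw [Fintype.card_fun]; push_cast; rfl
  have hterm : ∀ j : ZMod Q,
      ((Fintype.card (ZMod Q) : ℝ≥0∞) ^ Fintype.card ι)⁻¹ * discretizedGaussian Q α j *
          unitUniform {u : ℝ | (a, recontPhase Q (a ⬝ᵥ s + j) u) ∈ S} =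
        (Fintype.card (ι → ZMod Q) : ℝ≥0∞)⁻¹ *
          ∑' k : {k : ℤ // (k : ZMod Q) = j}, gaussianReal 0 (widthVar α) (cellIndex Q ⁻¹' {(k : ℤ)}) * V k := by
    intro j
    rw [hcard, discretizedGaussian_eq_tsum_cells Q α j, mul_assoc, ← ENNReal.tsum_mul_right]
    congr 1
    refine tsum_congr fun k => ?_
    obtain ⟨k, hk⟩ := k
    subst hk
    congr 1
    rw [hV]
    congr 1
    ext u
    simp only [Set.mem_setOf_eq]
    rw [recontPhase_add_eq]
  simp_rw [hterm]
  rw [← Finset.mul_sum, sum_tsum_fibre_eq_tsum Q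
    (fun k : ℤ => gaussianReal 0 (widthVar α) (cellIndex Q ⁻¹' {k}) * V k)]

/-- **The re-continuised `A_{s,Ψ̄_α}` is within `2/(αQ)` of `A_{s,Ψ_α}`** (the exact identity, one common
uniform factor, data processing). [folklore] -/
theorem statDist_recont_lweSample_torusLWESample_le {α : ℝ} (hα : 0 < α) (s : ι → ZMod Q) :
    statDist (recont Q (lweSample (discretizedGaussian Q α) s)) (torusLWESample Q (wrappedGaussian α) s) ≤
      2 / (α * Q) := by
  rw [recont_lweSample_discretizedGaussian, torusLWESample, torusLWESample]
  refine (statDist_map_le (measurable_torusSampleMap Q s) _ _).trans ?_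
  exact (statDist_prod_right_le _ _ _).trans (statDist_recontNoise_wrappedGaussian_le Q hα)

end LWE

end Literature.Computability.Cryptography

end
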